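import Literature.AlgebraicTopology.CharacteristicClasses.CompletionThomClassVectorPart
import Literature.AlgebraicTopology.CharacteristicClasses.TopChernNumberLocalization
import Literature.AlgebraicTopology.CharacteristicClasses.ChernClassModTwoReduction
import Literature.AlgebraicTopology.SingularHomology.CartanFormulaSqTwoDegreeFour
import Literature.AlgebraicTopology.SingularHomology.SteenrodSquaresRelative
import Literature.AlgebraicTopology.SingularHomology.SteenrodSquareOneBockstein
import Literature.AlgebraicTopology.SingularHomology.RelativeCupRight
import HarnessLib

/-!
# `Sq²` of the Thom class of a rank-two complex bundle: `Sq² t = t ⌣ c₁ (mod 2)`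

J. Milnor, J. Stasheff, *Characteristic Classes* (1974), §8 (Thom's definition of the
Stiefel–Whitney classes, `Sqᵏ(u) = (π^* wₖ) ⌣ u` for the Thom class `u ∈ Hⁿ(E, E₀; ℤ/2)`, Thm. 8.1/8.2)
with §14 Problem 14-B (`w₂(ξ_ℝ) ≡ c₁(ξ) (mod 2)` for a complex bundle `ξ`): for a complex vector bundle
of rank two the second Stiefel–Whitney class of the underlying real bundle, read off the Thom class, is
`c₁ mod 2`.  R. Bott, L. Tu, *Differential Forms in Algebraic Topology* (1982), §20–§21, for the
projective-completion model `P(E ⊕ ℂ) ⊃ P(E)` of the Thom pair `(E, E ∖ 0)`.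

For the tree's completion Thom class (`CompletionThomClass.lean`: `t_E = yᵏ + Σ q̂^* c_{k-j}(E) ⌣ yʲ`
on `D = P(E ⊕ ℂ)`; `CompletionThomClassVectorPart.lean`: the relative lift
`t̃_E ∈ H²ᵏ(D, D ∖ s₀(B); R)`), this file PROVES:

* `exists_complInclVec`, `map_vectorPartIncl_surjective` — the vector part `D ∖ s₀(B)`
  deformation-retracts onto the divisor at infinity `ι(P(E))`, so the restriction
  `Hᵐ(D) → Hᵐ(D ∖ s₀(B))` is onto (Leray–Hirsch for `P(E)`: every class is `ι^*` of a polynomial in `y`);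
* **`toAbsolute_vectorPart_injective`** — hence `Hʲ(D, D ∖ s₀(B); R) → Hʲ(D; R)` is INJECTIVE (`j ≥ 1`;
  exactness), and **`eq_relComplThomClass`**: the relative Thom class is the UNIQUE lift of `t_E`
  (Milnor–Stasheff Thm. 10.4: `H^*(E, E₀) → H^*(E)` is the ideal generated by the Thom class);
* `degCast_complThomClass_of_rank_two` — for rank `2`: `t_E = y ⌣ y + q̂^*c₁ ⌣ y + q̂^*c₂ ∈ H⁴(D; R)`;
* `steenrodSq_one_ringChange_int` — `Sq¹ ∘ ρ₂ = 0` on reductions of integral classes (`Sq¹ = β`,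
  Hatcher §3.E/§4.L), in particular `Sq¹ y = 0` for `y ∈ H²(D; ℤ/2)` (`yClass_modTwo`);
* **`steenrodSq_two_complThomClass`**: for rank `2` and a base with `H⁶(B; ℤ/2) = 0` (e.g. a
  `4`-manifold), `Sq² t_E = t_E ⌣ q̂^*c₁(E)` in `H⁶(D; ℤ/2)` — by the Cartan formula in bidegree `(2,2)`
  (`steenrodSq_two_cupProduct_22_zmod`), `Sq¹ y = 0`, `Sq²` of `q̂^*c₂` lands in `q̂^* H⁶(B) = 0`, and
  `y ⌣ y ⌣ y + y ⌣ y ⌣ y = 0`;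
* **`relSteenrodSq_two_relComplThomClass`** — the same for the relative Thom class in
  `H⁶(D, D ∖ s₀(B); ℤ/2)` (injectivity), i.e. Thom's `Sq² u = u ⌣ w₂` with `w₂ = c₁ mod 2`
  (`chernClassR_modTwo`: the class is the reduction of the integral `c₁`).

Everything is proved; no named facts.  Written for Wu's formula on almost complex `4`-manifolds.

## References

* J. Milnor, J. Stasheff, *Characteristic Classes*, Ann. of Math. Stud. 76, PUP 1974, §8 Thm. 8.1,
  §10 Thm. 10.4, §14 Problem 14-B. [MilnorStasheff1974]
* R. Bott, L. W. Tu, *Differential Forms in Algebraic Topology*, GTM 82, Springer 1982, §20–§21.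
  [BottTu1982]
* A. Hatcher, *Algebraic Topology*, CUP 2002, §3.E p. 303, §4.L p. 489. [HatcherAT2002]
-/

noncomputable section

open CategoryTheory Function Set Bundle Literature.AlgebraicTopology.SingularHomology
open scoped LinearAlgebra.Projectivization unitInterval

/-! ### `Sq¹` kills reductions of integral classes -/

namespace Literature.AlgebraicTopology.SingularHomology

/-- **`Sq¹ ∘ ρ₂ = 0`**: the first Steenrod square of the mod-2 reduction of an integral class vanishes
(`Sq¹` is the Bockstein `β = ρ₂ β̃`, Hatcher §4.L (6), and `β̃ ∘ ρ₂ = 0`: an integral cocycle lifts its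
own reduction, with `δy = 0 = 2·0`). [cite: HatcherAT2002, §3.E p. 303 and §4.L p. 489] -/
theorem steenrodSq_one_ringChange_int {X : Type} [TopologicalSpace X] {p : ℕ}
    (x : singularCohomology ℤ ℤ X p) :
    steenrodSq X p 1 (singularCohomology.ringChange (Int.castRingHom (ZMod 2)) X p x) = 0 := by
  induction x using singularCohomology_induction_on with
  | h z =>
  have hd : ∀ τ, (2 : ℤ) * (0 : SingularSimplex X (p + 1) → ℤ) τ =
      (singularCochainComplex ℤ ℤ X).d p (p + 1) (coFn z) τ := fun τ => by
    have h := congrFun (coboundary_coFn z) τ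
    rw [coboundary_eq] at h
    rw [h]
    simp
  rw [singularCohomology.ringChange_π, steenrodSq_one_eq_bocksteinModTwo,
    bocksteinModTwo_π (cocyclesRingChange (Int.castRingHom (ZMod 2)) p z) (coFn z)
      (fun s => by rw [coFn_cocyclesRingChange]; rfl) 0 hd,
    ← map_zero (ConcreteCategory.hom (singularCohomology.π (ZMod 2) (ZMod 2) X (p + 1)))]
  congr 1
  refine coFn_injective ?_
  rw [coFn_cocyclesRingChange, coFn_cocyclesMk, coFn_zero]
  funext τ
  exact map_zero _

end Literature.AlgebraicTopology.SingularHomology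

namespace Literature.AlgebraicTopology.CharacteristicClasses

namespace ComplexVectorBundle

variable {B : Type} [TopologicalSpace B] (E : ComplexVectorBundle.{0, 0} B)

/-! ### Transport of relative classes along degree equalities -/

/-- `j^*` commutes with degree transport. [folklore] -/
theorem toAbsolute_relDegCast (R : Type) [CommRing R] {X : Type} [TopologicalSpace X] {A : Set X} {a b : ℕ}
    (e : a = b) (u : relSingularCohomology R R X A a) :
    relSingularCohomology.toAbsolute R R X A b (relDegCast R e u) =
      degCast R e (relSingularCohomology.toAbsolute R R X A a u) := by
  subst e; rfl

/-- Pull-back of pairs commutes with degree transport. [folklore] -/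
theorem relMap_relDegCast (R : Type) [CommRing R] {X X' : Type} [TopologicalSpace X] [TopologicalSpace X']
    {A : Set X} {A' : Set X'} (f : C(X', X)) (hf : MapsTo f A' A) {a b : ℕ} (e : a = b)
    (u : relSingularCohomology R R X A a) :
    relSingularCohomology.map R R f hf b (relDegCast R e u) = relDegCast R e (relSingularCohomology.map R R f hf a u) := by
  subst e; rfl

/-! ### The vector part retracts onto the divisor at infinity -/

section Retract

variable (hE : 0 < E.rank)

/-- `ι` lands in the vector part: `[v : 0]` has `v ≠ 0`. [cite: BottTu1982, §20] -/
theorem complIncl_mem_vectorPart (p : E.Proj) : E.complIncl hE p ∈ vectorPart E.F E.E := by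
  obtain ⟨b, ℓ⟩ := p
  induction ℓ using Projectivization.ind with
  | h w hw =>
    rw [E.complIncl_apply_mk hE hw]
    exact (mk_mem_vectorPart_iff b w 0 _).2 hw

/-- The fibrewise scaling keeps the vector part inside itself. [cite: MilnorStasheff1974, §9] -/
theorem vectorPartScaleFun_mem (q : I × ↥(vectorPart E.F E.E)) : vectorPartScaleFun E.F E.E q ∈ vectorPart E.F E.E := by
  obtain ⟨t, ⟨⟨b, ℓ⟩, hp⟩⟩ := q
  induction ℓ using Projectivization.ind with
  | h w hw =>
    obtain ⟨v, z⟩ := w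
    have hv : v ≠ 0 := (mk_mem_vectorPart_iff b v z hw).1 hp
    change (⟨b, lineScale _ (Projectivization.mk ℂ (v, z) hw)⟩ : ProjCompl E.F E.E) ∈ vectorPart E.F E.E
    rw [lineScale_mk _ hv z hw]
    exact (mk_mem_vectorPart_iff b v _ _).2 hv

/-- **The vector part deformation-retracts onto `ι(P(E))`**: there is a map `ι₀ : P(E) → D ∖ s₀(B)`
(the inclusion `ι` of the divisor at infinity, corestricted) such that the scaling
`[v : z] ↦ [v : (1 - t) z]` is a homotopy, INSIDE `D ∖ s₀(B)`, from the identity to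
`ι₀ ∘ ([v : z] ↦ [v])` (Milnor–Stasheff §9: `E₀` retracts; Bott–Tu §20: the complement of the zero
section retracts onto the divisor at infinity). [cite: MilnorStasheff1974, §9] [cite: BottTu1982, §20] -/
theorem exists_complInclVec :
    ∃ ι₀ : C(E.Proj, ↥(vectorPart E.F E.E)), E.vectorPartIncl.comp ι₀ = E.complIncl hE ∧
      (ContinuousMap.id ↥(vectorPart E.F E.E)).Homotopic (ι₀.comp E.vectorPartProj) := by
  refine ⟨⟨fun p ↦ ⟨E.complIncl hE p, E.complIncl_mem_vectorPart hE p⟩,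
    (E.complIncl hE).continuous.subtype_mk _⟩, rfl, ⟨?_⟩⟩
  exact
    { toFun := fun q ↦ ⟨vectorPartScaleFun E.F E.E q, E.vectorPartScaleFun_mem q⟩
      continuous_toFun := (continuous_vectorPartScaleFun E.F E.E).subtype_mk _
      map_zero_left := fun p ↦ Subtype.ext ((E.vectorPartComplHomotopy hE).map_zero_left p)
      map_one_left := fun p ↦ Subtype.ext ((E.vectorPartComplHomotopy hE).map_one_left p) }

variable (R : Type) [CommRing R]

variable [T2Space B] [ParacompactSpace B]

include hE in
/-- **The restriction `Hᵐ(D; R) → Hᵐ(D ∖ s₀(B); R)` is surjective**: a class `z` on the vector part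
is `pr^* ι₀^* z`, and `ι₀^* z ∈ Hᵐ(P(E))` is a polynomial `Σ q^*aⱼ ⌣ xʲ` (Leray–Hirsch for `P(E)`),
which is `ι^*` of `Σ q̂^*aⱼ ⌣ yʲ` (`ι^* y = x`); finally the restriction is `pr^* ∘ ι^*` up to the
homotopy of the vector part. [cite: MilnorStasheff1974, §10 Thm. 10.4] -/
theorem map_vectorPartIncl_surjective (m : ℕ) : Surjective (singularCohomology.map R R E.vectorPartIncl m) := by
  intro z
  obtain ⟨ι₀, -, ⟨Hι⟩⟩ := E.exists_complInclVec hE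
  obtain ⟨a, ha⟩ := (E.projectiveBundle_lerayHirsch (E.k0 hE) R m).2 (singularCohomology.map R R ι₀ m z)
  refine ⟨LerayHirsch.lhMap R (LerayHirsch.evenDeg E.rank) E.compl.projMap (fun j : Fin E.rank ↦ cupPow R (E.yClass R) j) m a, ?_⟩
  rw [singularCohomology.map_eq_of_homotopic_holds R R ⟨E.vectorPartComplHomotopy hE⟩ m,
    singularCohomology.map_comp, ModuleCat.comp_apply,
    LerayHirsch.map_lhMap R (LerayHirsch.evenDeg E.rank) E.compl.projMap E.projMap (E.complIncl hE) (ContinuousMap.id B)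
      (E.projMap_comp_complIncl hE)]
  have hfam : (fun j : Fin E.rank ↦ singularCohomology.map R R (E.complIncl hE) (LerayHirsch.evenDeg E.rank j)
      (cupPow R (E.yClass R) j)) = E.projBundleCls (E.k0 hE) R := by
    funext j
    change singularCohomology.map R R (E.complIncl hE) (2 * (j : ℕ)) (cupPow R (E.yClass R) j) = _
    rw [map_cupPow, E.map_complIncl_yClass R hE, projBundleCls_eq]
  have hsrc : (fun j : LerayHirsch.Idx (LerayHirsch.evenDeg E.rank) m ↦
      singularCohomology.map R R (ContinuousMap.id B) (m - LerayHirsch.evenDeg E.rank j.1) (a j)) = a := by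
    funext j
    rw [singularCohomology.map_id]
    rfl
  rw [hfam, hsrc, ha, ← ModuleCat.comp_apply, ← singularCohomology.map_comp,
    ← singularCohomology.map_eq_of_homotopic_holds R R ⟨Hι⟩ m, singularCohomology.map_id]
  rfl

include hE in
/-- **`Hʲ(D, D ∖ s₀(B); R) → Hʲ(D; R)` is injective for `j ≥ 1`**: its kernel is the image of
`δ : Hʲ⁻¹(D ∖ s₀(B)) → Hʲ(D, D ∖ s₀(B))`, and `δ` vanishes on restrictions of global classes — which
is everything (Milnor–Stasheff Thm. 10.4: `H^*(E, E₀) ↪ H^*(E)` onto the ideal of the Thom class).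
[cite: MilnorStasheff1974, §10 Thm. 10.4] -/
theorem toAbsolute_vectorPart_injective {i j : ℕ} (hij : i + 1 = j) :
    Injective (relSingularCohomology.toAbsolute R R E.compl.Proj (vectorPart E.F E.E) j) := by
  intro a b hab
  rw [← sub_eq_zero]
  have h0 : relSingularCohomology.toAbsolute R R E.compl.Proj (vectorPart E.F E.E) j (a - b) = 0 := by
    rw [map_sub, hab, sub_self]
  have hex := relSingularCohomology.exact_δ_toAbsolute (R := R) (M := R) (X := E.compl.Proj)
    (vectorPart E.F E.E) i j hij
  rw [ShortComplex.moduleCat_exact_iff] at hex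
  obtain ⟨w, hw⟩ := hex (a - b) h0
  obtain ⟨Z, rfl⟩ := E.map_vectorPartIncl_surjective hE R i w
  rw [← hw]
  exact congrFun (congrArg DFunLike.coe (congrArg ModuleCat.Hom.hom
    ((relShortComplex_shortExact R R (vectorPart E.F E.E)).comp_δ i j hij))) Z

/-- **Uniqueness of the relative Thom class**: a relative class lifting `t_E` IS `t̃_E`.
[cite: MilnorStasheff1974, §10 Thm. 10.4] -/
theorem eq_relComplThomClass (u : relSingularCohomology R R E.compl.Proj (vectorPart E.F E.E) (2 * E.rank))
    (hu : relSingularCohomology.toAbsolute R R E.compl.Proj (vectorPart E.F E.E) (2 * E.rank) u = E.complThomClass R) :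
    u = E.relComplThomClass R hE :=
  E.toAbsolute_vectorPart_injective hE R (i := 2 * E.rank - 1) (by omega)
    (hu.trans (E.toAbsolute_relComplThomClass R hE).symm)

end Retract

/-! ### Rank two: `t_E = y ⌣ y + q̂^*c₁ ⌣ y + q̂^*c₂` and `Sq² t_E = t_E ⌣ q̂^*c₁` -/

section RankTwo

variable [T2Space B] [ParacompactSpace B] (R : Type) [CommRing R]

/-- **Rank two**: transported to `H⁴(D; R)`, the Thom class of a rank-`2` bundle is
`t_E = y ⌣ y + q̂^*c₁(E) ⌣ y + q̂^*c₂(E)` (Husemoller's defining polynomial of the Chern classes,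
Bott–Tu (20.7)). [cite: BottTu1982, §20 (20.7)] -/
theorem degCast_complThomClass_of_rank_two (hk : E.rank = 2) (h4 : 2 * E.rank = 4) :
    degCast R h4 (E.complThomClass R) =
      cupProduct (p := 2) (q := 2) (n := 4) rfl (E.yClass R) (E.yClass R)
        + cupProduct (p := 2) (q := 2) (n := 4) rfl
            (singularCohomology.map R R E.compl.projMap 2 (E.chernClassR R 1)) (E.yClass R)
        + singularCohomology.map R R E.compl.projMap 4 (E.chernClassR R 2) := by
  have key : ∀ k : ℕ, k = 2 → ∀ h4 : 2 * k = 4,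
      degCast R h4 (cupPow R (E.yClass R) k +
        lhSum R E.compl.projMap (E.yClass R) (K := 2 * k) (fun j : Fin k ↦ 2 * (k - (j : ℕ)))
          (fun j ↦ by have := j.isLt; omega) (fun j : Fin k ↦ E.chernClassR R (k - (j : ℕ)))) =
      cupProduct (p := 2) (q := 2) (n := 4) rfl (E.yClass R) (E.yClass R)
        + cupProduct (p := 2) (q := 2) (n := 4) rfl
            (singularCohomology.map R R E.compl.projMap 2 (E.chernClassR R 1)) (E.yClass R)
        + singularCohomology.map R R E.compl.projMap 4 (E.chernClassR R 2) := by
    rintro k rfl h4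
    rw [lhSum, Fin.sum_univ_two]
    change cupProduct (p := 2) (q := 2) (n := 4) rfl
          (cupProduct (p := 0) (q := 2) (n := 2) rfl (singularCohomology.one R E.compl.Proj) (E.yClass R))
          (E.yClass R)
        + (cupProduct (p := 4) (q := 0) (n := 4) rfl
              (singularCohomology.map R R E.compl.projMap 4 (E.chernClassR R 2)) (singularCohomology.one R E.compl.Proj)
          + cupProduct (p := 2) (q := 2) (n := 4) rfl
              (singularCohomology.map R R E.compl.projMap 2 (E.chernClassR R 1))
              (cupProduct (p := 0) (q := 2) (n := 2) rfl (singularCohomology.one R E.compl.Proj) (E.yClass R))) = _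
    rw [one_cupProduct, cupProduct_one]
    abel
  exact key E.rank hk h4

/-- **`y_{ℤ/2} = ρ₂ y_ℤ`** for the class of the completed bundle. [cite: HusemollerFibreBundles1994, Ch. 17 §2] -/
theorem yClass_modTwo :
    E.yClass (ZMod 2) = singularCohomology.ringChange (Int.castRingHom (ZMod 2)) E.compl.Proj 2 (E.yClass ℤ) :=
  E.compl.xClass_modTwo E.rank_compl_pos

/-- **`Sq¹ y = 0`** (`y` is the reduction of an integral class). [cite: HatcherAT2002, §4.L p. 489] -/
theorem steenrodSq_one_yClass : steenrodSq E.compl.Proj 2 1 (E.yClass (ZMod 2)) = 0 := by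
  rw [E.yClass_modTwo]
  exact steenrodSq_one_ringChange_int _

/-- **`Sq² t_E = t_E ⌣ q̂^*c₁(E)` in `H⁶(D; ℤ/2)`** for a rank-`2` bundle over a base with
`H⁶(B; ℤ/2) = 0`: Thom's identity `Sq²(u) = u ⌣ w₂` (Milnor–Stasheff Thm. 8.1/8.2) with
`w₂ = c₁ mod 2` (Problem 14-B), here obtained from the explicit polynomial: by Cartan in bidegree
`(2, 2)` and `Sq¹ y = 0`, `Sq²(y ⌣ y) = y²⌣y + y⌣y² = 0`, `Sq²(q̂^*c₁ ⌣ y) = (q̂^*c₁)² ⌣ y + q̂^*c₁ ⌣ y²`,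
`Sq²(q̂^*c₂) ∈ q̂^*H⁶(B) = 0`; while `t_E ⌣ q̂^*c₁ = y² ⌣ q̂^*c₁ + (q̂^*c₁ ⌣ y) ⌣ q̂^*c₁ + q̂^*(c₂ ⌣ c₁)`, and the
two agree by graded commutativity. [cite: MilnorStasheff1974, §8 Thm. 8.1 and §14 Problem 14-B] -/
theorem steenrodSq_two_complThomClass (hk : E.rank = 2) (h4 : 2 * E.rank = 4)
    (h6 : ∀ z : singularCohomology (ZMod 2) (ZMod 2) B 6, z = 0) :
    steenrodSq E.compl.Proj 4 2 (degCast (ZMod 2) h4 (E.complThomClass (ZMod 2))) =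
      cupProduct (p := 4) (q := 2) (n := 6) rfl (degCast (ZMod 2) h4 (E.complThomClass (ZMod 2)))
        (singularCohomology.map (ZMod 2) (ZMod 2) E.compl.projMap 2 (E.chernClassR (ZMod 2) 1)) := by
  have hsgn : (-1 : ZMod 2) = 1 := by decide
  have hxx : ∀ x : singularCohomology (ZMod 2) (ZMod 2) E.compl.Proj 6, x + x = 0 := fun x ↦ by
    rw [← two_smul (ZMod 2) x, show (2 : ZMod 2) = 0 from rfl, zero_smul]
  rw [E.degCast_complThomClass_of_rank_two (ZMod 2) hk h4]
  set y := E.yClass (ZMod 2) with hy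
  set a := singularCohomology.map (ZMod 2) (ZMod 2) E.compl.projMap 2 (E.chernClassR (ZMod 2) 1) with ha
  set b := singularCohomology.map (ZMod 2) (ZMod 2) E.compl.projMap 4 (E.chernClassR (ZMod 2) 2) with hb
  have hy1 : steenrodSq E.compl.Proj 2 1 y = 0 := E.steenrodSq_one_yClass
  have hb2 : steenrodSq E.compl.Proj 4 2 b = 0 := by
    rw [hb, ← steenrodSq_map, h6 (steenrodSq B 4 2 _), map_zero]
  have hba : cupProduct (p := 4) (q := 2) (n := 6) rfl b a = 0 := by
    rw [hb, ha, ← cupProduct_map, h6 (cupProduct (p := 4) (q := 2) (n := 6) rfl _ _), map_zero]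
  have h1 : cupProduct (p := 4) (q := 2) (n := 6) rfl (cupProduct (p := 2) (q := 2) (n := 4) rfl y y) y =
      cupProduct (p := 2) (q := 4) (n := 6) rfl y (cupProduct (p := 2) (q := 2) (n := 4) rfl y y) :=
    cupProduct_assoc rfl rfl rfl rfl y y y
  have h2 : cupProduct (p := 4) (q := 2) (n := 6) rfl (cupProduct (p := 2) (q := 2) (n := 4) rfl y y) a =
      cupProduct (p := 2) (q := 4) (n := 6) rfl a (cupProduct (p := 2) (q := 2) (n := 4) rfl y y) := by
    have h := cupProduct_gradedComm_holds (ZMod 2) E.compl.Proj (p := 4) (q := 2) (n := 6) rfl rfl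
      (cupProduct (p := 2) (q := 2) (n := 4) rfl y y) a
    rwa [hsgn, one_pow, one_smul] at h
  have hya : cupProduct (p := 2) (q := 2) (n := 4) rfl y a = cupProduct (p := 2) (q := 2) (n := 4) rfl a y := by
    have h := cupProduct_gradedComm_holds (ZMod 2) E.compl.Proj (p := 2) (q := 2) (n := 4) rfl rfl y a
    rwa [hsgn, one_pow, one_smul] at h
  have h3 : cupProduct (p := 4) (q := 2) (n := 6) rfl (cupProduct (p := 2) (q := 2) (n := 4) rfl a y) a =
      cupProduct (p := 4) (q := 2) (n := 6) rfl (cupProduct (p := 2) (q := 2) (n := 4) rfl a a) y := by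
    rw [cupProduct_assoc rfl rfl rfl (rfl : 2 + 4 = 6) a y a, hya,
      ← cupProduct_assoc (rfl : 2 + 2 = 4) rfl rfl rfl a a y]
  rw [map_add, map_add, steenrodSq_two_cupProduct_22_zmod, steenrodSq_two_cupProduct_22_zmod, hy1, hb2]
  simp only [map_zero, add_zero]
  rw [LinearMap.map_add₂, LinearMap.map_add₂, h1, hxx, zero_add, h2, h3, hba, add_zero]
  exact add_comm _ _

/-- **`Sq² t̃_E = t̃_E ⌣ q̂^*c₁(E)` in `H⁶(D, D ∖ s₀(B); ℤ/2)`** — Thom's `Sq²(u) = u ⌣ w₂(E_ℝ)` for the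
RELATIVE Thom class of a rank-`2` complex bundle over a base with `H⁶(B; ℤ/2) = 0`, with
`w₂ = c₁ mod 2` (from the absolute identity and the injectivity of `H⁶(D, D ∖ s₀(B)) → H⁶(D)`).
[cite: MilnorStasheff1974, §8 Thm. 8.1 and §14 Problem 14-B] -/
theorem relSteenrodSq_two_relComplThomClass (hE : 0 < E.rank) (hk : E.rank = 2) (h4 : 2 * E.rank = 4)
    (h6 : ∀ z : singularCohomology (ZMod 2) (ZMod 2) B 6, z = 0) :
    relSteenrodSqLower E.compl.Proj 4 (vectorPart E.F E.E) 6 2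
        (relDegCast (ZMod 2) h4 (E.relComplThomClass (ZMod 2) hE)) =
      relSingularCohomology.cupRight (p := 4) (q := 2) (n := 6) rfl
        (relDegCast (ZMod 2) h4 (E.relComplThomClass (ZMod 2) hE))
        (singularCohomology.map (ZMod 2) (ZMod 2) E.compl.projMap 2 (E.chernClassR (ZMod 2) 1)) := by
  refine E.toAbsolute_vectorPart_injective hE (ZMod 2) (i := 5) rfl ?_
  rw [toAbsolute_relSteenrodSqLower, relSingularCohomology.toAbsolute_cupRight, toAbsolute_relDegCast,
    E.toAbsolute_relComplThomClass]
  exact E.steenrodSq_two_complThomClass hk h4 h6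

/-- The coefficient class is the reduction of the integral first Chern class:
`q̂^*c₁(E)_{ℤ/2} = ρ₂ q̂^*c₁(E)_ℤ`. [cite: MilnorStasheff1974, §14 Problem 14-B] -/
theorem map_projMap_chernClassR_one_modTwo :
    singularCohomology.map (ZMod 2) (ZMod 2) E.compl.projMap 2 (E.chernClassR (ZMod 2) 1) =
      singularCohomology.ringChange (Int.castRingHom (ZMod 2)) E.compl.Proj 2
        (singularCohomology.map ℤ ℤ E.compl.projMap 2 (E.chernClassR ℤ 1)) := by
  have h : E.chernClassR (ZMod 2) 1 = singularCohomology.ringChange (Int.castRingHom (ZMod 2)) B 2 (E.chernClassR ℤ 1) :=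
    E.chernClassR_modTwo 1
  rw [h, ringChange_map]

end RankTwo

end ComplexVectorBundle

end Literature.AlgebraicTopology.CharacteristicClasses
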